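import Summits.RiemannHypothesis.RiemannHypothesis.Theses.OddSector
import HarnessLib

/-!
# RiemannHypothesis / OddSector — assembly item `Assembly`

Route `RiemannHypothesis/OddSector` (RH from a one-signed ODD ground state of Weil's windowed
quadratic form on unboundedly many windows), item `stmt-RiemannHypothesis-17364`:

  `Assembly := OddBartaFloor → OddOneSignedWindows → OddNegativityOffLine → Summit.RiemannHypothesis`

(the type of the route's deciding theorem `closes`).

The implication is pure logic over the three cruxes, by contradiction. If RH fails,
`OddNegativityOffLine` (Yoshida's odd criterion in contrapositive, window-uniform form) gives
`η > 0` and a height `A` beyond which every window `a` carries an `L²`-normalised smooth odd test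
`h` supported in `[-a, a]` with `Re Q(h) ≤ -η`; `OddBartaFloor` gives `e → 0` and a height `a₀`
beyond which every window carrying a one-signed odd bottom state has the floor `-e(a) ≤ Re Q(h)`
for all such tests; and `OddOneSignedWindows` supplies a window with a one-signed odd bottom state
beyond any prescribed height — in particular beyond `max (max A a₀) A₁`, where `A₁` is chosen with
`e a < η` for `a ≥ A₁`. At that window `-e(a) ≤ Re Q(h) ≤ -η < -e(a)`, a contradiction. The only
arithmetic is on the reals `e a`, `η`; the `let`-inlined Weil vocabulary (autocorrelation `C`,
Mellin–Laplace transform `M`, Weil functional `Q`) is shared verbatim by the three items, so the two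
energy bounds chain by `le_trans`.

We give the proof directly (it is the same argument as the gate-written `closes`), and record as an
`example` that the item is literally the type of `closes`. Nothing here is new mathematics and no
auxiliary declaration is introduced.

References for the route: H. Yoshida, *On Hermitian forms attached to zeta functions* (1992)
[Yoshida1992HermitianForms]; E. Bombieri, *Remarks on Weil's quadratic functional in the theory of
prime numbers, I* (2000) [Bombieri2000Weil].
-/

-- D-0017: single-problem summit ⇒ namespace `Summit.RiemannHypothesis.RiemannHypothesis.…` by design
-- (the Summits library sets `weak.linter.dupNamespace = false`; repeated here for standalone checks).
set_option linter.dupNamespace false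

namespace Summit.RiemannHypothesis.RiemannHypothesis.Theorems

open Summit.RiemannHypothesis.RiemannHypothesis.Theses.OddSector

/-- **Item `stmt-RiemannHypothesis-17364` (`OddSector.Assembly`).** The three cruxes of route
`OddSector` imply the Riemann hypothesis: by contradiction, if RH fails then
`OddNegativityOffLine` yields `η > 0` and, at every large window `a`, a normalised smooth odd test
`h` on `[-a, a]` with `Re Q(h) ≤ -η`; `OddBartaFloor` yields the floor `-e(a) ≤ Re Q(h)` with
`e → 0` at every large window carrying a one-signed odd bottom state; and `OddOneSignedWindows`
supplies such a window beyond any height, in particular one with `e a < η` — so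
`-e(a) ≤ Re Q(h) ≤ -η < -e(a)`, absurd. Pure logic plus `linarith` on `e a`, `η`. [folklore] -/
theorem oddSectorAssembly_proof :
    Summit.RiemannHypothesis.RiemannHypothesis.Theses.OddSector.Assembly := by
  unfold Summit.RiemannHypothesis.RiemannHypothesis.Theses.OddSector.Assembly
  intro hBarta hSign hNeg
  show _root_.RiemannHypothesis
  by_contra hRH
  obtain ⟨η, hη, A, hAneg⟩ := hNeg hRH
  obtain ⟨e, he, a₀, hfloor⟩ := hBarta
  have hev : ∀ᶠ a in Filter.atTop, e a < η := he.eventually (Iio_mem_nhds hη)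
  obtain ⟨A₁, hA₁⟩ := Filter.eventually_atTop.1 hev
  obtain ⟨a, ha, u, hu, hsign⟩ := hSign (max (max A a₀) A₁)
  have haA : A ≤ a := le_trans (le_trans (le_max_left _ _) (le_max_left _ _)) ha
  have ha₀ : a₀ ≤ a := le_trans (le_trans (le_max_right _ _) (le_max_left _ _)) ha
  have haA₁ : A₁ ≤ a := le_trans (le_max_right _ _) ha
  obtain ⟨h, hh, hsupp, hodd, hnorm, hneg⟩ := hAneg a haA
  have h1 := hfloor a ha₀ ⟨u, hu, hsign⟩ h hh hsupp hodd hnorm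
  have h2 : e a < η := hA₁ a haA₁
  have h3 : -e a ≤ -η := le_trans h1 hneg
  linarith

-- Consistency check: the item is literally the type of the route's deciding theorem `closes`.
example : Summit.RiemannHypothesis.RiemannHypothesis.Theses.OddSector.Assembly :=
  closes

end Summit.RiemannHypothesis.RiemannHypothesis.Theorems
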